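import Summits.CriticalPhenomena.PercolationContinuityZ3.Theorems.PercNearOneGluingNoHeavyLowerTailKnQuestion8CoefficientwiseRootSetKernelRowTwo
import Summits.CriticalPhenomena.PercolationContinuityZ3.Theorems.PercNearOneGluingNoHeavyLowerTailKnQuestion8CoefficientwiseRootSetKernelRowTwoNonAdj
import Summits.CriticalPhenomena.PercolationContinuityZ3.Theorems.PercNearOneGluingNoHeavyLowerTailKnQuestion8CoefficientwiseRootSetKernelRowTwoNoAq
import Summits.CriticalPhenomena.PercolationContinuityZ3.Theorems.PercNearOneGluingNoHeavyLowerTailKnQuestion8CoefficientwiseRootSetKernelRowTwoNoBy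
import Summits.CriticalPhenomena.PercolationContinuityZ3.Theorems.PercNearOneGluingNoHeavyLowerTailKnQuestion8CoefficientwiseRootSetKernelRowTwoYIsolated
import HarnessLib

/-!
# The root-set kernel: ROW 2 OF RCSET FOR EVERY MULTIGRAPH — prim-lf-2 gen 60

Support file (`--supports stmt-CriticalPhenomena-4575`, closed), prover `prim-lf-2` (gen 60).  No definitions, no named facts, no sorries; standard axioms.
Memo `prim-lf-2/CW-ATOM-gen60.md` §5.  This file only assembles the five cases proved in the companion files:
`rcset_row_two` (gen 59: `U ∼ q`, `U ∼ y`, `q ∼ y`), `rcset_row_two_nonadj` (`U ∼ q`, `U ∼ y`, `q ≁ y`), `rcset_row_two_noAq` (`U ≁ q`), `rcset_row_two_noBy` (`U ∼ q`, `U ≁ y`, `q ∼ y`),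
`rcset_row_two_yIsolated` (`U ∼ q`, `y` isolated).

THE ROOT-SET KERNEL (memo CW-IGCEX-gen58 §8b).  Multigraph `ends : ι → Sym2 V`, edge set `E`, target `y`; `R_A(t) = {v | ∃ a ∈ A, v ∈ C_a(t)}`, `B_A(t) = R_A(E ∖ t)`,
`Φ(A, A') = Σ_{t ⊆ E : ¬(y ∈ R_A(t) ∧ y ∈ B_{A'}(t))} (f R_A(t) − f B_{A'}(t))·(g R_A(t) − g B_{A'}(t))`.  CONJECTURE RCSET (prim-lf-2 gen 58): `Φ(S',S') ≤ 2·Φ(S,S')` for nested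
`S ⊆ S' ∌ y`; the bottom pair is CONJECTURE NO-CORE (`noCore_of_rcset_pair`), the top row `S' = V ∖ y` is `rcset_top_row` (gen 58).
* `Coefficientwise.rcset_row_two_all` — **THEOREM: ROW 2 OF RCSET**, unconditionally: for every finite multigraph, `y ≠ q`, `U = V ∖ {y,q}`, every `S` with `y, q ∉ S`, and all monotone
  `f, g`:  `Φ(U,U) ≤ 2·Φ(S,U)`.
[cite: KozmaNitzan2024, Questions 8–9 (§5.5 p. 36) (context: the Question-8 pocket covariance programme)]
-/

namespace Summit.CriticalPhenomena.PercolationContinuityZ3.Theorems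

open Finset Literature.Probability.Percolation

namespace Coefficientwise

variable {ι V : Type*}

open Classical in
/-- **Row 2 of RCSET, all multigraphs**: for finite `V`, `y ≠ q`, `U = V ∖ {y, q}`, `y, q ∉ S` and monotone `f, g`:  `Φ(U,U) ≤ 2·Φ(S,U)` for the root-set kernel `Φ` of
`(ends, E, y, f, g)`. [cite: KozmaNitzan2024, Questions 8–9 (§5.5 p. 36) (context)] -/
theorem rcset_row_two_all [Fintype V] [DecidableEq V] (ends : ι → Sym2 V) (E : Finset ι) (y q : V) (hyq : y ≠ q) (S : Finset V) (hyS : y ∉ S) (hqS : q ∉ S)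
    (f g : Set V → ℝ) (hf : Monotone f) (hg : Monotone g) :
    (∑ s ∈ E.powerset.filter (fun s : Finset ι =>
          ¬ ((∃ a ∈ ((Finset.univ : Finset V).erase y).erase q, y ∈ openCluster (ends '' (↑s : Set ι)) a) ∧
             (∃ a ∈ ((Finset.univ : Finset V).erase y).erase q, y ∈ openCluster (ends '' (↑(E \ s) : Set ι)) a))),
        (f {v | ∃ a ∈ ((Finset.univ : Finset V).erase y).erase q, v ∈ openCluster (ends '' (↑s : Set ι)) a} -
            f {v | ∃ a ∈ ((Finset.univ : Finset V).erase y).erase q, v ∈ openCluster (ends '' (↑(E \ s) : Set ι)) a}) *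
          (g {v | ∃ a ∈ ((Finset.univ : Finset V).erase y).erase q, v ∈ openCluster (ends '' (↑s : Set ι)) a} -
            g {v | ∃ a ∈ ((Finset.univ : Finset V).erase y).erase q, v ∈ openCluster (ends '' (↑(E \ s) : Set ι)) a})) ≤
    2 * ∑ s ∈ E.powerset.filter (fun s : Finset ι =>
          ¬ ((∃ a ∈ S, y ∈ openCluster (ends '' (↑s : Set ι)) a) ∧
             (∃ a ∈ ((Finset.univ : Finset V).erase y).erase q, y ∈ openCluster (ends '' (↑(E \ s) : Set ι)) a))),
        (f {v | ∃ a ∈ S, v ∈ openCluster (ends '' (↑s : Set ι)) a} -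
            f {v | ∃ a ∈ ((Finset.univ : Finset V).erase y).erase q, v ∈ openCluster (ends '' (↑(E \ s) : Set ι)) a}) *
          (g {v | ∃ a ∈ S, v ∈ openCluster (ends '' (↑s : Set ι)) a} -
            g {v | ∃ a ∈ ((Finset.univ : Finset V).erase y).erase q, v ∈ openCluster (ends '' (↑(E \ s) : Set ι)) a}) := by
  by_cases hA : ∃ i ∈ E, ∃ u : V, u ≠ q ∧ u ≠ y ∧ ends i = s(u, q)
  · by_cases hB : ∃ i ∈ E, ∃ u : V, u ≠ q ∧ u ≠ y ∧ ends i = s(u, y)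
    · by_cases hC : ∃ i ∈ E, ends i = s(q, y)
      · exact rcset_row_two ends E y q hyq S hyS hqS hA hB hC f g hf hg
      · have hnCq : ∀ i ∈ E, ends i ≠ s(q, y) := fun i hi h => hC ⟨i, hi, h⟩
        exact rcset_row_two_nonadj ends E y q hyq S hyS hqS hA hB hnCq f g hf hg
    · have hnBy : ∀ i ∈ E, ∀ u : V, u ≠ q → u ≠ y → ends i ≠ s(u, y) := fun i hi u h1 h2 h3 => hB ⟨i, hi, u, h1, h2, h3⟩
      by_cases hC : ∃ i ∈ E, ends i = s(q, y)
      · exact rcset_row_two_noBy ends E y q hyq S hyS hqS hA hC hnBy f g hf hg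
      · -- `y` is isolated: a non-loop edge at `y` would be a `U–y` or the `q–y` edge
        have hy : ∀ i ∈ E, ∀ w : V, w ≠ y → ends i ≠ s(w, y) := by
          intro i hi w hwy h
          by_cases hwq : w = q
          · exact hC ⟨i, hi, by rw [h, hwq]⟩
          · exact hnBy i hi w hwq hwy h
        exact rcset_row_two_yIsolated ends E y q hyq S hyS hqS hy f g hf hg
  · have hnAq : ∀ i ∈ E, ∀ u : V, u ≠ q → u ≠ y → ends i ≠ s(u, q) := fun i hi u h1 h2 h3 => hA ⟨i, hi, u, h1, h2, h3⟩
    exact rcset_row_two_noAq ends E y q hyq S hyS hqS hnAq f g hf hg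

end Coefficientwise

end Summit.CriticalPhenomena.PercolationContinuityZ3.Theorems
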